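import Literature.Topology.FourManifolds.LickorishWallace
import Literature.Topology.FourManifolds.CerfGammaFourProofs
import Literature.Topology.FourManifolds.SmoothOrientationDiffeomorphProofs
import HarnessLib

/-!
# Lickorish–Wallace, step F2b refined: `S³ = H ∪_i H'` with `f⁻¹ ∘ i` orientation preserving

Topic `Literature/Topology/FourManifolds`; companion to `LickorishWallace.lean` (the decomposition
of the Lickorish–Wallace fact `Literature.Topology.FourManifolds.exists_isIntegralSurgeryLink` along Lickorish's proof of
his Thm 2). There, step **F2b** is the named fact `Literature.Topology.FourManifolds.IsHandlebody.exists_isBoundaryGluing_sphere`: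
for genus-`g` handlebodies `H`, `H'` and any diffeomorphism `f : ∂H ≅ ∂H'` there are
`i : ∂H ≅ ∂H'` with `S³ = H ∪_i H'` and an orientation `o` of `∂H` for which `f⁻¹ ∘ i` is
orientation preserving (Lickorish, Ann. of Math. 76 (1962), pp. 538–539: "There is a piecewise
linear homeomorphism `i` such that `i : X₁ → X₂` and `S³ = T₁ ∪_i T₂`. We can choose `i` so that
`f⁻¹ i` is orientation preserving").

This file splits F2b into its two classical ingredients and **proves** F2b from them:

* **F2b₁** `Literature.Topology.FourManifolds.IsHandlebody.exists_diffeomorph_isBoundaryGluing_sphere` — `S³` is the union of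
  *any* two genus-`g` handlebodies along some diffeomorphism of their boundaries (all genus-`g`
  handlebodies are diffeomorphic, Schultens (2014), §6.1, Exercise 2, and `S³` has a genus-`g`
  Heegaard splitting for every `g`, Schultens Ex. 6.1.8–6.1.9, Juhász (2023), p. 97; Lickorish
  p. 538, first sentence quoted above). Named fact.
* **F2b₂** `Literature.Topology.FourManifolds.IsHandlebody.exists_diffeomorph_isOrientationReversing_boundary` — "every
  handlebody admits an orientation-reversing symmetry" (Juhász (2023), §3.5, p. 97): a
  self-diffeomorphism `R` of `H` restricting on `∂H` to a diffeomorphism `r` that reverses an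
  orientation `o` of the (orientable) surface `∂H`. Named fact.
* `Literature.Topology.FourManifolds.IsHandlebody.exists_isBoundaryGluing_sphere_of` — **F2b from F2a, F2b₁, F2b₂** (proved):
  given `S³ = H ∪_{i₀} H'`, either `f⁻¹ ∘ i₀` preserves `o` (done), or it reverses `o`
  (dichotomy on the connected surface `∂H`,
  `Diffeomorph.isOrientationPreserving_or_isOrientationReversing_holds`), and then
  `i := i₀ ∘ r` works: `S³ = H ∪_{i₀ ∘ r} H'` by re-gluing through the extension `R`
  (`Literature.Topology.FourManifolds.IsBoundaryGluing.comp_diffeomorph`), and `f⁻¹ ∘ i₀ ∘ r` preserves `o` as a composite of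
  two orientation-reversing diffeomorphisms (`Literature.Topology.FourManifolds.IsOrientationPreserving.comp_holds`). This is
  exactly Lickorish's "We can choose `i` so that `f⁻¹ i` is orientation preserving".
* `Literature.Topology.FourManifolds.exists_isIntegralSurgeryLink_of_lickorish'` — the assembly of
  `LickorishWallace.lean` re-threaded through F2b₁, F2b₂ (proved).

## References

* W. B. R. Lickorish, Ann. of Math. (2) 76 (1962), pp. 538–539.
* J. Schultens, *Introduction to 3-Manifolds*, GSM 151 (2014), §6.1 (Ex. 6.1.8–6.1.9, Exercise 2).
* A. Juhász, *Differential and Low-Dimensional Topology* (2023), §3.5, p. 97.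
* M. W. Hirsch, *Differential Topology* (1976), §4.4 (orientation-preserving/reversing maps).
-/

open scoped Manifold ContDiff Topology
open Function Set

noncomputable section

namespace Literature.Topology.FourManifolds

universe u

/-- Local notation: `𝔼 n` is the model Euclidean space `EuclideanSpace ℝ (Fin n)`. -/
local notation "𝔼 " n:arg => EuclideanSpace ℝ (Fin n)

/-- Local notation: `𝕊 n` is the unit sphere in `EuclideanSpace ℝ (Fin (n + 1))`. -/
local notation "𝕊 " n:arg => (Metric.sphere (0 : EuclideanSpace ℝ (Fin (n + 1))) 1)

/-- **`S³` is the union of any two genus-`g` handlebodies** (F2b₁). For genus-`g` handlebodies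
`H`, `H'` (`Literature.Topology.FourManifolds.IsHandlebody`) with boundary data `b`, `b'` there is a diffeomorphism
`i : ∂H ≅ ∂H'` with `𝕊 3 = H ∪_i H'` (`Literature.IsBoundaryGluing b b' i (𝓡 3) (𝕊 3)`). Ingredients:
all genus-`g` handlebodies are diffeomorphic (Schultens, *Introduction to 3-Manifolds* (2014),
§6.1, Exercise 2) and `S³` has a genus-`g` Heegaard splitting into two of them for every `g`
(Schultens, Ex. 6.1.8–6.1.9; Juhász (2023), p. 97: "`S³` has a genus `g` Heegaard decomposition
for every `g`"); Lickorish (1962), p. 538: "There is a piecewise linear homeomorphism `i` such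
that `i : X₁ → X₂` and `S³ = T₁ ∪_i T₂`." Named fact (D-0014).
[cite: LickorishAnnals1962, p. 538; Schultens2014 §6.1, Ex. 6.1.8–6.1.9 and Exercise 2; Juhasz2023 §3.5 (p. 97)] -/
def IsHandlebody.exists_diffeomorph_isBoundaryGluing_sphere : Prop :=
  ∀ (g : ℕ) (H : Type u) [TopologicalSpace H] [T2Space H] [SecondCountableTopology H]
    [ChartedSpace (EuclideanHalfSpace 3) H] [IsManifold (𝓡∂ 3) ∞ H]
    (H' : Type u) [TopologicalSpace H'] [T2Space H'] [SecondCountableTopology H']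
    [ChartedSpace (EuclideanHalfSpace 3) H'] [IsManifold (𝓡∂ 3) ∞ H']
    (_hH : IsHandlebody g H) (_hH' : IsHandlebody g H')
    (b : BoundaryData (𝓡∂ 3) H (𝓡 2)) (b' : BoundaryData (𝓡∂ 3) H' (𝓡 2)),
    ∃ i : b.carrier ≃ₘ⟮𝓡 2, 𝓡 2⟯ b'.carrier, IsBoundaryGluing b b' i (𝓡 3) (𝕊 3)

/-- **Every handlebody admits an orientation-reversing symmetry** (F2b₂; Juhász, *Differential
and Low-Dimensional Topology* (2023), §3.5, p. 97: "every handlebody admits an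
orientation-reversing symmetry" — e.g. the reflection of `♮^g (S¹ × D²) ⊆ ℝ³` in a plane
containing the cores of the handles). Formally: for a genus-`g` handlebody `H` with boundary datum
`b` there are an orientation `o` of the boundary surface `∂H` (which is orientable), a
self-diffeomorphism `R` of `H` and a self-diffeomorphism `r` of `∂H` such that `R` restricts to
`r` on the boundary (`R ∘ incl = incl ∘ r`) and `r` reverses `o`. Named fact (D-0014).
[cite: Juhasz2023, §3.5 (p. 97)] -/
def IsHandlebody.exists_diffeomorph_isOrientationReversing_boundary : Prop :=
  ∀ (g : ℕ) (H : Type u) [TopologicalSpace H] [T2Space H] [SecondCountableTopology H]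
    [ChartedSpace (EuclideanHalfSpace 3) H] [IsManifold (𝓡∂ 3) ∞ H] (_hH : IsHandlebody g H)
    (b : BoundaryData (𝓡∂ 3) H (𝓡 2)),
    ∃ (o : SmoothOrientation (𝓡 2) b.carrier) (R : H ≃ₘ⟮𝓡∂ 3, 𝓡∂ 3⟯ H)
      (r : b.carrier ≃ₘ⟮𝓡 2, 𝓡 2⟯ b.carrier),
      (∀ z, R (b.incl z) = b.incl (r z)) ∧ r.IsOrientationReversing o o

/-- The composite of two orientation-reversing diffeomorphisms is orientation preserving
(Hirsch, *Differential Topology* (1976), §4.4; from `Literature.Topology.FourManifolds.IsOrientationPreserving.comp_holds` and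
`Diffeomorph.det_mfderiv_ne_zero`). [folklore] -/
theorem Diffeomorph.isOrientationPreserving_trans_of_isOrientationReversing
    {E HM : Type*} [NormedAddCommGroup E] [NormedSpace ℝ E] [TopologicalSpace HM]
    {I : ModelWithCorners ℝ E HM} {M : Type*} [TopologicalSpace M] [ChartedSpace HM M]
    [IsManifold I 1 M] {oM : SmoothOrientation I M} {φ ψ : M ≃ₘ⟮I, I⟯ M}
    (hφ : φ.IsOrientationReversing oM oM) (hψ : ψ.IsOrientationReversing oM oM) :
    (φ.trans ψ).IsOrientationPreserving oM oM := by
  have hφ' : IsOrientationPreserving oM (-oM) φ := hφ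
  have hψ' : IsOrientationPreserving (-oM) oM ψ := by
    rw [← isOrientationPreserving_neg_neg_iff, neg_neg]
    exact hψ
  have h := IsOrientationPreserving.comp_holds hψ' hφ' (ψ.mdifferentiable (by simp))
    (φ.mdifferentiable (by simp)) (fun y ↦ ψ.det_mfderiv_ne_zero (by simp) y)
    (fun x ↦ φ.det_mfderiv_ne_zero (by simp) x)
  exact h

/-- **F2b from F2a, F2b₁ and F2b₂** (Lickorish (1962), pp. 538–539: "We can choose `i` so that
`f⁻¹ i` is orientation preserving"). Given `S³ = H ∪_{i₀} H'` (F2b₁), an orientation `o` of the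
connected (F2a) surface `∂H` and an orientation-reversing symmetry `r = R|∂H` of `H` (F2b₂): if
`f⁻¹ ∘ i₀` preserves `o` take `i = i₀`; otherwise it reverses `o` (dichotomy for diffeomorphisms of
a connected manifold, `Diffeomorph.isOrientationPreserving_or_isOrientationReversing_holds`), and
`i = i₀ ∘ r` works: `S³ = H ∪_{i₀ ∘ r} H'` by re-gluing through `R`
(`Literature.Topology.FourManifolds.IsBoundaryGluing.comp_diffeomorph`), and `f⁻¹ ∘ i₀ ∘ r` preserves `o` as the composite of two
orientation-reversing diffeomorphisms. [cite: LickorishAnnals1962, pp. 538–539] -/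
theorem IsHandlebody.exists_isBoundaryGluing_sphere_of
    (h₂ : IsHandlebody.connectedSpace_boundary.{u})
    (hS : IsHandlebody.exists_diffeomorph_isBoundaryGluing_sphere.{u})
    (hR : IsHandlebody.exists_diffeomorph_isOrientationReversing_boundary.{u}) :
    IsHandlebody.exists_isBoundaryGluing_sphere.{u} := by
  intro g H _ _ _ _ _ H' _ _ _ _ _ hH hH' b b' f
  obtain ⟨i₀, hi₀⟩ := hS g H H' hH hH' b b'
  obtain ⟨o, R, r, hRr, hrev⟩ := hR g H hH b
  haveI : ConnectedSpace b.carrier := h₂ g H hH b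
  rcases Diffeomorph.isOrientationPreserving_or_isOrientationReversing_holds (i₀.trans f.symm)
      (by simp) o o with hp | hrv
  · exact ⟨i₀, o, hi₀, hp⟩
  · refine ⟨r.trans i₀, o, ?_, ?_⟩
    · exact hi₀.comp_diffeomorph R r.toEquiv hRr fun z ↦ rfl
    · exact Diffeomorph.isOrientationPreserving_trans_of_isOrientationReversing hrev hrv

/-- **Lickorish–Wallace from the refined steps**: the assembly
`Literature.Topology.FourManifolds.exists_isIntegralSurgeryLink_of_lickorish` of `LickorishWallace.lean` with F2b replaced
by its ingredients F2b₁ (`S³ = H ∪ H'`) and F2b₂ (orientation-reversing symmetry).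
Lickorish (1962), proof of Thm 2, pp. 538–540. [cite: LickorishAnnals1962, Thm. 2 and its proof (pp. 538–540)] -/
theorem exists_isIntegralSurgeryLink_of_lickorish'
    (h₁ : exists_isHeegaardSplitting.{u}) (h₂ : IsHandlebody.connectedSpace_boundary.{u})
    (hS : IsHandlebody.exists_diffeomorph_isBoundaryGluing_sphere.{u})
    (hR : IsHandlebody.exists_diffeomorph_isOrientationReversing_boundary.{u})
    (h₄ : exists_isDehnTwist_isIsotopic_listProd.{u})
    (h₅ : exists_isIntegralSurgeryLink_of_isBoundaryGluing_of_isIsotopic_listProd.{u}) :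
    FourManifolds.exists_isIntegralSurgeryLink.{u} :=
  FourManifolds.exists_isIntegralSurgeryLink_of_lickorish h₁ h₂
    (IsHandlebody.exists_isBoundaryGluing_sphere_of h₂ hS hR) h₄ h₅

end Literature.Topology.FourManifolds
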